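import Mathlib
import Summits.NavierStokesRegularity.NavierStokesRegularity.Theorems.EulerZoomLiouvillePowerGaugeEulerLiouvilleSelfSimilarFiniteHyperbolic
import HarnessLib

/-!
# Rung C1 of the crux `EulerZoomLiouville.PowerGaugeEulerLiouville`: at a stagnation point the linearised similarity
# flow is the matrix exponential `D(Φ_s)(z) = exp(s · DW(z))` (route №10, item stmt-NavierStokesRegularity-19832;
# `--supports`)

Helper file (theorems only). Seat ns-typeII-p3 (cell ns-regularity-ideate §B, D-0081).  First sequel to
`…SelfSimilarFiniteHyperbolic` (step (M) of the crux idea «hyperbolic-stagnation exclusion»: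
`eq_zero_of_finiteHyperbolicStagnation` — finite stagnation set, every node a generic source or THIN ⇒ `V ≡ 0`, where
THIN is a hyperbolic splitting `Es ⊕ Eu`, `Eu ≠ ⊤`, of the derivative of the TIME-ONE MAP `Φ_1` of the similarity flow
at the node, the form the Stable Manifold fact consumes).  This file identifies that derivative with data of the
linearisation `DW(z) = γI + DV(z)` itself:

* `hasDerivAt_fderiv_flow_of_mem_nodalSet` — at `z ∈ 𝒩_W` the variational equation has constant coefficients,
  `d/ds D(Φ_s)(z) = DW(z) ∘ D(Φ_s)(z)`;
* **`fderiv_flow_eq_exp_smul`** — `D(Φ_s)(z) = exp(s · DW(z))` for all `s` (both solve `X' = DW(z) X`, `X(0) = I`;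
  uniqueness for the globally Lipschitz linear field `X ↦ DW(z) X` on the operator algebra);
* **`fderiv_flow_one_eq_exp`** — `D(Φ_1)(z) = exp DW(z)`.

The sequels `…SelfSimilarExpSplitting` (Lyapunov pairs ⇒ hyperbolic splitting of `exp A`) and
`…SelfSimilarGenericHyperbolic` (generic saddles are thin; the idea card's theorem for generic hyperbolic stagnation
sets) consume it.  WHAT THIS IS NOT: not NS, not E, not rung C1 — linear ODE bookkeeping for classical profiles.
[folklore; cf. Robinson1999 Ch. V §5.10.3 (flows via the time-one map); ConstantinIgnatovaVicol2026Putative §3.4.1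
(3.22)]
-/

noncomputable section

-- flat `Theorems/<Route><Decl>…` files of one crux share the namespace of the crux (tree convention)
set_option linter.dupNamespace false

open MeasureTheory Set Filter Topology Metric Function InnerProductSpace
open scoped RealInnerProductSpace NNReal ContDiff Nat

namespace Summit.NavierStokesRegularity.NavierStokesRegularity.Theorems.PowerGaugeEulerLiouville.Kelvin

open Literature.Analysis Literature.Analysis.FluidPDE Literature.Dynamics.FixedPoints

variable {γ : ℝ} {V : EuclideanSpace ℝ (Fin 3) → EuclideanSpace ℝ (Fin 3)} {P : EuclideanSpace ℝ (Fin 3) → ℝ}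

/-! ### A. At a stagnation point the linearised flow is `exp(s · DW(z))` -/

/-- At a stagnation point `z` the variational equation has CONSTANT coefficients:
`d/ds D(Φ_s)(z) = DW(z) ∘ D(Φ_s)(z)`, `DW(z) = γI + DV(z)`. [cite: ConstantinIgnatovaVicol2026Putative, §3.4.1 eq. (3.22)] -/
theorem hasDerivAt_fderiv_flow_of_mem_nodalSet (hV : ContDiff ℝ ∞ V) {K : ℝ} (hK : ∀ y, ‖fderiv ℝ V y‖ ≤ K)
    {z : EuclideanSpace ℝ (Fin 3)} (hz : z ∈ selfSimilarNodalSet γ 0 V) (s : ℝ) :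
    HasDerivAt (fun r => fderiv ℝ (ODE.evolutionMap (fun _ : ℝ => selfSimilarTransport γ 0 V) 0 r) z)
      ((γ • ContinuousLinearMap.id ℝ (EuclideanSpace ℝ (Fin 3)) + fderiv ℝ V z) *
        fderiv ℝ (ODE.evolutionMap (fun _ : ℝ => selfSimilarTransport γ 0 V) 0 s) z) s := by
  have h := hasDerivAt_fderiv_flow (γ := γ) hV hK s z
  rw [flow_eq_self_of_mem_nodalSet hV hK hz s] at h
  exact h

/-- **The linearised similarity flow at a stagnation point is the matrix exponential**:
`D(Φ_s)(z) = exp(s · DW(z))` for every `s ∈ ℝ` (both sides solve `X' = DW(z) X` with `X(0) = I`; uniqueness for the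
globally Lipschitz linear field `X ↦ DW(z) X`).  In particular `D(Φ_1)(z) = exp DW(z)`, the operator whose hyperbolic
splitting the Stable Manifold Theorem consumes. [cite: Robinson1999, Ch. V §5.10.3 (flows: the time-one map)] -/
theorem fderiv_flow_eq_exp_smul (hV : ContDiff ℝ ∞ V) {K : ℝ} (hK : ∀ y, ‖fderiv ℝ V y‖ ≤ K)
    {z : EuclideanSpace ℝ (Fin 3)} (hz : z ∈ selfSimilarNodalSet γ 0 V) (s : ℝ) :
    fderiv ℝ (ODE.evolutionMap (fun _ : ℝ => selfSimilarTransport γ 0 V) 0 s) z =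
      NormedSpace.exp (s • (γ • ContinuousLinearMap.id ℝ (EuclideanSpace ℝ (Fin 3)) + fderiv ℝ V z)) := by
  set A : EuclideanSpace ℝ (Fin 3) →L[ℝ] EuclideanSpace ℝ (Fin 3) :=
    γ • ContinuousLinearMap.id ℝ (EuclideanSpace ℝ (Fin 3)) + fderiv ℝ V z with hA
  have hf : ∀ t : ℝ, HasDerivAt
      (fun r => fderiv ℝ (ODE.evolutionMap (fun _ : ℝ => selfSimilarTransport γ 0 V) 0 r) z)
      (A * fderiv ℝ (ODE.evolutionMap (fun _ : ℝ => selfSimilarTransport γ 0 V) 0 t) z) t ∧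
      fderiv ℝ (ODE.evolutionMap (fun _ : ℝ => selfSimilarTransport γ 0 V) 0 t) z ∈ (univ : Set _) :=
    fun t => ⟨hasDerivAt_fderiv_flow_of_mem_nodalSet hV hK hz t, mem_univ _⟩
  have hg : ∀ t : ℝ, HasDerivAt (fun r : ℝ => NormedSpace.exp (r • A)) (A * NormedSpace.exp (t • A)) t ∧
      NormedSpace.exp (t • A) ∈ (univ : Set _) :=
    fun t => ⟨hasDerivAt_exp_smul_const' A t, mem_univ _⟩
  have hv : ∀ _t : ℝ, LipschitzOnWith ‖A‖₊
      (fun U : EuclideanSpace ℝ (Fin 3) →L[ℝ] EuclideanSpace ℝ (Fin 3) => A * U) univ := by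
    intro t
    refine (lipschitzWith_iff_norm_sub_le.2 fun U W => ?_).lipschitzOnWith
    rw [← mul_sub]
    exact norm_mul_le _ _
  have key := ODE_solution_unique_univ (v := fun _ U => A * U) (s := fun _ => univ) (t₀ := 0) hv hf hg ?_
  · exact congrFun key s
  · show fderiv ℝ (ODE.evolutionMap (fun _ : ℝ => selfSimilarTransport γ 0 V) 0 0) z =
      NormedSpace.exp ((0 : ℝ) • A)
    rw [fderiv_evolutionMap_self, show ((0 : ℝ) • A) = 0 from zero_smul ℝ A, NormedSpace.exp_zero]
    rfl

/-- In particular **`D(Φ_1)(z) = exp DW(z)`** at every stagnation point `z`. [cite: Robinson1999, Ch. V §5.10.3 (flows: the time-one map)] -/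
theorem fderiv_flow_one_eq_exp (hV : ContDiff ℝ ∞ V) {K : ℝ} (hK : ∀ y, ‖fderiv ℝ V y‖ ≤ K)
    {z : EuclideanSpace ℝ (Fin 3)} (hz : z ∈ selfSimilarNodalSet γ 0 V) :
    fderiv ℝ (ODE.evolutionMap (fun _ : ℝ => selfSimilarTransport γ 0 V) 0 1) z =
      NormedSpace.exp (γ • ContinuousLinearMap.id ℝ (EuclideanSpace ℝ (Fin 3)) + fderiv ℝ V z) := by
  rw [fderiv_flow_eq_exp_smul hV hK hz 1,
    show ((1 : ℝ) • (γ • ContinuousLinearMap.id ℝ (EuclideanSpace ℝ (Fin 3)) + fderiv ℝ V z)) =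
      γ • ContinuousLinearMap.id ℝ (EuclideanSpace ℝ (Fin 3)) + fderiv ℝ V z from one_smul ℝ _]


end Summit.NavierStokesRegularity.NavierStokesRegularity.Theorems.PowerGaugeEulerLiouville.Kelvin

end
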